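import Literature.NumberTheory.EllipticCurves.PeriodIndexCorestriction
import Literature.NumberTheory.EllipticCurves.IwasawaSelmerProofs
import Literature.NumberTheory.EllipticCurves.SubgroupSelmerProofs
import Literature.NumberTheory.EllipticCurves.BSDSelmerParityDokchitserBaseChangeProofs
import HarnessLib

/-!
# `rk_p(E/K) = corank Sel_{p^∞}(E/L)^{Gal(L/K)}` (Dokchitser–Dokchitser 2010, Lemma 4.14) in the subgroup model

T. Dokchitser, V. Dokchitser, *On the Birch–Swinnerton-Dyer quotients modulo squares*, Ann. of
Math. 172 (2010), Lemma 4.14: "Let `E/K` be an elliptic curve, and let `F/K` be a finite Galois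
extension with Galois group `G`. Then `rk_p(E/K) = dim_{ℚ_p} X_p(E/F)^G`. *Proof.* The
restriction map from `H¹(K, E[pⁿ])` to `H¹(F, E[pⁿ])^G` induces a map
`Sel_{pⁿ}(E/K) → Sel_{pⁿ}(E/F)^G` whose kernel and cokernel are killed by `|G|²`. Taking direct
limits gives a map from `Sel_{p^∞}(E/K)` to `Sel_{p^∞}(E/F)^G`, whose kernel and cokernel are
killed by `|G|²`. The result follows by taking duals and tensoring with `ℚ_p`."

This file PROVES the statement at the level of `ℤ_p`-coranks of the discrete Selmer groups, in
the tree's subgroup model of `Sel_{p^∞}(E/F)` (`WeierstrassCurve.selmerGroupOver W p H` of file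
`SubgroupSelmer`: `F = K̄^H` for an open normal subgroup `H ≤ Γ_K` of finite index `|G|`, the
Selmer conditions at all places of `F` being the conjugates of the local kernels at the places of
`K`; for `H = ⊤` it is `Sel_{p^∞}(E/K)`, `selmerGroupOver_top_holds`):

* `index_nsmul_mem_selmerGroupPInfty_of_resSubgroupH1_mem` — **the local half of "cokernel killed
  by `|G|²`"**: if the restriction of `η ∈ H¹(K, E[p^∞])` to `H` satisfies the Selmer conditions
  over `F`, then `|G| η ∈ Sel_{p^∞}(E/K)`: at a place `v` of `K`, the local class of `η` dies on
  the open subgroup `H_{K_v} = (Γ_{K_v} → Γ_K)⁻¹(H)` of `Γ_{K_v}` of index dividing `|G|`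
  (functoriality of restriction), hence `|G| η` dies on `Γ_{K_v}` (`cor ∘ res = index`, the
  tree's `index_nsmul_eq_zero_of_resSubgroupH1_eq_zero` of `PeriodIndexCorestriction` applied
  to `Γ_{K_v}`);
* `exists_resSubgroupH1_eq_index_nsmul_of_forall_conjH1_eq` — **the global half**: a class of
  `H¹(H, E[p^∞])` fixed by the conjugation action of `Γ_K` is, after multiplication by `|G|`, a
  restriction (`res ∘ cor = ∑_{G} g_*`, the tree's `resSubgroupH1_coresH1`);
* `selmerCorank_eq_zpCorank_selmerGroupOverInvariants` — **Lemma 4.14**: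
  `corank_{ℤ_p} Sel_{p^∞}(E/K) = corank_{ℤ_p} (Sel_{p^∞}(E/F)^G)`, the restriction
  `Sel_{p^∞}(E/K) → Sel_{p^∞}(E/F)^G` having kernel killed by `|G|` and cokernel killed by
  `|G|²` (quasi-isomorphism invariance of the corank, `zpCorank_eq_of_nsmul_ker_of_nsmul_coker`).
  The finiteness of the `p`-torsion of `Sel_{p^∞}(E/F)^G` (the `p`-Selmer group of `E/F` is
  finite) is an explicit hypothesis `hfin` here: in the subgroup model it is the comparison with
  `Sel_{p^∞}(E_F/F)` of file `Selmer`, not carried out in this file.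

Everything here is proved; no named fact is introduced.

## References

* T. Dokchitser, V. Dokchitser, Ann. of Math. 172 (2010) = arXiv:math/0610290, Lemma 4.14
  (arXiv: Lemma 47) and its proof. [DokchitserDokchitserAnnals2010]
* R. Greenberg, *Iwasawa theory for elliptic curves*, LNM 1716 (1999), §2 (Selmer groups over
  algebraic extensions), §3 (restriction maps). [GreenbergLNM1716]
* J.-P. Serre, *Galois Cohomology* (1997), I.§2.4 (res, cor). [SerreGaloisCohomology1997]
-/

noncomputable section

open scoped Classical AddSubgroup

universe u

namespace Literature.NumberTheory.EllipticCurves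

open GaloisRepresentations WeierstrassCurve

/-! ## Generic addenda: invariant classes are restrictions up to the index -/

section Generic

variable {G : Type u} [Group G] [TopologicalSpace G] [IsTopologicalGroup G]
variable (N : Subgroup G) [N.Normal] [N.FiniteIndex]
variable {M : Type u} [AddCommGroup M] [DistribMulAction G M] [TopologicalSpace M]
  [DiscreteTopology M]

/-- **`[G : N] • H¹(N, M)^G ⊆ res H¹(G, M)`**: a class of `H¹(N, M)` fixed by every conjugation
`g_*` is, after multiplication by the index, the restriction of its corestriction
(`res (cor ξ) = ∑_{x ∈ G/N} (s x)_* ξ = [G : N] ξ`). Dokchitser–Dokchitser 2010, proof of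
Lemma 4.14 (cokernel of `Sel(E/K) → Sel(E/F)^G`). [cite: DokchitserDokchitserAnnals2010, Lemma 4.14 (proof)] -/
theorem exists_resSubgroupH1_eq_index_nsmul_of_forall_conjH1_eq (hN : IsOpen (N : Set G))
    {ξ : subgroupH1 N M} (hξ : ∀ g : G, conjH1 N M g ξ = ξ) :
    ∃ x : discreteH1 G M, resSubgroupH1 N M x = N.index • ξ := by
  haveI : Fintype (G ⧸ N) := Fintype.ofFinite _
  refine ⟨coresH1 N hN ξ, ?_⟩
  rw [resSubgroupH1_coresH1 N hN (s := Quotient.out) QuotientGroup.out_eq' ξ,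
    Finset.sum_congr rfl fun x _ ↦ hξ _, Finset.sum_const, Finset.card_univ,
    ← Nat.card_eq_fintype_card, ← Subgroup.index_eq_card]

omit [N.FiniteIndex] in
/-- The conjugation action of `G` on `H¹(N, M)` factors through `G ⧸ N`: `(g n)_* = g_*` for
`n ∈ N` (`conjH1_mul`, `conjH1_of_mem`). Serre, *Local Fields*, VII.§5, Prop. 3. [folklore] -/
theorem conjH1_mul_of_mem (g : G) {n : G} (hn : n ∈ N) (ξ : subgroupH1 N M) :
    conjH1 N M (g * n) ξ = conjH1 N M g ξ := by
  rw [conjH1_mul_holds N M g n, AddMonoidHom.comp_apply, conjH1_of_mem_holds N M hn,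
    AddMonoidHom.id_apply]

omit [N.FiniteIndex] in
/-- **Invariance under one generator.** If every element of `G` has the form `n c^k` (`n ∈ N`;
e.g. `G ⧸ N` cyclic generated by `c N`), a class fixed by `c_*` is fixed by all of `G`.
[folklore] -/
theorem conjH1_eq_self_of_generator {c : G} (hc : ∀ g : G, ∃ (n : N) (k : ℕ), g = n * c ^ k)
    {ξ : subgroupH1 N M} (hξ : conjH1 N M c ξ = ξ) (g : G) : conjH1 N M g ξ = ξ := by
  obtain ⟨n, k, rfl⟩ := hc g
  rw [conjH1_mul_holds N M (n : G) (c ^ k), AddMonoidHom.comp_apply]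
  have hk : ∀ k : ℕ, conjH1 N M (c ^ k) ξ = ξ := by
    intro k
    induction k with
    | zero => rw [pow_zero, conjH1_one_holds N M, AddMonoidHom.id_apply]
    | succ k ih => rw [pow_succ, conjH1_mul_holds N M, AddMonoidHom.comp_apply, hξ, ih]
  rw [hk, conjH1_of_mem_holds N M n.2, AddMonoidHom.id_apply]

omit [N.Normal] [N.FiniteIndex] in
/-- Restriction to `N` factors through restriction to `⊤`: `res_N = res_{N ≤ ⊤} ∘ res_⊤`.
[folklore] -/
theorem resSubgroupH1_eq_resOfLe_comp :
    resSubgroupH1 N M = (resOfLe M (le_top : N ≤ ⊤)).comp (resSubgroupH1 ⊤ M) := by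
  rw [resSubgroupH1, resSubgroupH1, resOfLe, resH1Hom_comp]
  exact resH1Hom_congr (by ext; rfl) (by ext; rfl) _ _

omit [N.FiniteIndex] in
/-- Conjugation fixes restricted classes: `g_* (res_N x) = res_N x` (through `⊤`, where every
`g_*` is the identity). Serre, *Local Fields*, VII.§5, Prop. 3. [folklore] -/
theorem conjH1_resSubgroupH1_eq (g : G) (x : discreteH1 G M) :
    conjH1 N M g (resSubgroupH1 N M x) = resSubgroupH1 N M x := by
  rw [resSubgroupH1_eq_resOfLe_comp, AddMonoidHom.comp_apply]
  exact conjH1_resOfLe_of_mem M le_top (Subgroup.mem_top g) _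

omit [N.Normal] [N.FiniteIndex] in
/-- `H¹(N, M)` is `p`-primary when `N` is compact and `M` is `p`-primary (a continuous cocycle
takes finitely many values). Greenberg (1999), §2. [folklore] -/
theorem exists_pow_nsmul_eq_zero_subgroupH1 [CompactSpace G] (hN : IsClosed (N : Set G)) {p : ℕ}
    (hM : ∀ m : M, ∃ k : ℕ, p ^ k • m = 0) (x : subgroupH1 N M) : ∃ k : ℕ, p ^ k • x = 0 := by
  haveI : CompactSpace N := isCompact_iff_compactSpace.mp hN.isCompact
  obtain ⟨f, rfl⟩ := oneCocycleClass_surjective _ x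
  obtain ⟨k, hk⟩ := exists_pow_smul_apply_eq_zero f.1 fun g ↦ hM (f.1 g)
  exact ⟨k, nsmul_oneCocycleClass_eq_zero f (p ^ k) hk⟩

end Generic

/-! ## The local subgroups `H_E = (Γ_E → Γ_K)⁻¹(H)` have index dividing `[Γ_K : H]` -/

section LocalSubgroup

variable {K : Type u} [Field K] (H : Subgroup (Field.absoluteGaloisGroup K))
variable {E : Type u} [Field E] [Algebra K E] (ι : AlgebraicClosure K →ₐ[K] AlgebraicClosure E)

/-- `H_E` is open for `H` open (any `K`-embedding `ι : K̄ → K̄_E`). [folklore] -/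
theorem isOpen_localSubgroupOfEmb (hH : IsOpen (H : Set (Field.absoluteGaloisGroup K))) :
    IsOpen (localSubgroupOfEmb H ι : Set (Field.absoluteGaloisGroup E)) :=
  hH.preimage (resGalOfEmb ι).continuous_toFun

/-- `[Γ_E : H_E]` divides `[Γ_K : H]` for `H` normal (`Γ_E / H_E ↪ Γ_K / H`). [folklore] -/
theorem index_localSubgroupOfEmb_dvd [H.Normal] : (localSubgroupOfEmb H ι).index ∣ H.index := by
  rw [localSubgroupOfEmb, Subgroup.index_comap]
  exact Subgroup.relIndex_dvd_index_of_normal _ _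

/-- `H_E` has finite index for `H` normal of finite index. [folklore] -/
instance finiteIndex_localSubgroupOfEmb [H.Normal] [H.FiniteIndex] :
    (localSubgroupOfEmb H ι).FiniteIndex :=
  ⟨fun h0 ↦ Subgroup.FiniteIndex.index_ne_zero
    (Nat.eq_zero_of_zero_dvd (h0 ▸ index_localSubgroupOfEmb_dvd H ι))⟩

end LocalSubgroup

end Literature.NumberTheory.EllipticCurves

/-! ## The Selmer groups -/

namespace WeierstrassCurve

open Literature.NumberTheory.EllipticCurves Literature.NumberTheory.GaloisRepresentations

variable {K : Type} [Field K] [NumberField K] (W : WeierstrassCurve K) (p : ℕ)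
variable (H : Subgroup (Field.absoluteGaloisGroup K)) [H.Normal]

section Local

variable {E : Type} [Field E] [Algebra K E]

omit [NumberField K] in
/-- **One place.** If `res_H η` dies in `H¹(H_E, E(K̄_E))` then `[Γ_K : H] • η` dies in
`H¹(Γ_E, E(K̄_E))`: the local restriction of `res_H η` is the restriction to the open subgroup
`H_E ≤ Γ_E`, of index dividing `[Γ_K : H]`, of the local class of `η` (functoriality), and a
class dying on such a subgroup is killed by its index (`index_nsmul_eq_zero_of_resSubgroupH1_eq_zero`
on `Γ_E`, i.e. `cor ∘ res = index`). Dokchitser–Dokchitser 2010, proof of Lemma 4.14.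
[cite: DokchitserDokchitserAnnals2010, Lemma 4.14 (proof)] -/
theorem index_nsmul_mem_selmerLocalKerPrimary_of_resSubgroupH1_mem [H.FiniteIndex]
    (hH : IsOpen (H : Set (Field.absoluteGaloisGroup K))) {η : W.galH1Primary p}
    (hη : resSubgroupH1 H (geomPrimaryTorsion W p) η ∈ W.localKerOver p H E) :
    H.index • η ∈ selmerLocalKerPrimary W E p := by
  rw [localKerOver_eq_ofEmb, localKerOverOfEmb, AddMonoidHom.mem_ker] at hη
  -- the local class of `η`
  set ξ := resH1Hom (resGal (K := K) E) ((pointsMap W E).comp (geomPrimaryTorsion W p).subtype)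
    (W.pointsMap_comp_subtype_smul p) η with hξ
  -- the local restriction of `res_H η` is `res_{H_E} ξ` (functoriality of restriction)
  have key : W.localResOverOfEmb p H (closureEmb (K := K) E)
      (resSubgroupH1 H (geomPrimaryTorsion W p) η) =
      resSubgroupH1 (localSubgroupOfEmb H (closureEmb (K := K) E)) (localPoints W E) ξ := by
    rw [hξ, localResOverOfEmb, resSubgroupH1, resSubgroupH1,
      ← AddMonoidHom.comp_apply, ← AddMonoidHom.comp_apply, resH1Hom_comp, resH1Hom_comp]
    exact DFunLike.congr_fun (resH1Hom_congr (by ext; rfl) (by ext; rfl) _ _) η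
  have hres : resSubgroupH1 (localSubgroupOfEmb H (closureEmb (K := K) E)) (localPoints W E) ξ = 0 := by
    rw [← key]; exact hη
  -- killed by the index of `H_E`, which divides `[Γ_K : H]`
  haveI : Fintype (Field.absoluteGaloisGroup E ⧸ localSubgroupOfEmb H (closureEmb (K := K) E)) :=
    Fintype.ofFinite _
  have hkill := index_nsmul_eq_zero_of_resSubgroupH1_eq_zero
    (localSubgroupOfEmb H (closureEmb (K := K) E))
    (isOpen_localSubgroupOfEmb H (closureEmb (K := K) E) hH) hres
  obtain ⟨d, hd⟩ := index_localSubgroupOfEmb_dvd H (closureEmb (K := K) E)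
  rw [mem_selmerLocalKerPrimary_iff, map_nsmul, ← hξ, hd, mul_nsmul, hkill, nsmul_zero]

end Local

/-- **The local half: `res_H η ∈ Sel_{p^∞}(E/F) ⇒ [Γ_K : H] • η ∈ Sel_{p^∞}(E/K)`.**
Dokchitser–Dokchitser 2010, proof of Lemma 4.14 ("cokernel killed by `|G|²`").
[cite: DokchitserDokchitserAnnals2010, Lemma 4.14 (proof)] -/
theorem index_nsmul_mem_selmerGroupPInfty_of_resSubgroupH1_mem [H.FiniteIndex]
    (hH : IsOpen (H : Set (Field.absoluteGaloisGroup K))) {η : W.galH1Primary p}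
    (hη : resSubgroupH1 H (geomPrimaryTorsion W p) η ∈ W.selmerGroupOver p H) :
    H.index • η ∈ selmerGroupPInfty W p := by
  rw [mem_selmerGroupOver_iff] at hη
  rw [selmerGroupPInfty, AddSubgroup.mem_inf, AddSubgroup.mem_iInf, AddSubgroup.mem_iInf]
  refine ⟨fun v ↦ ?_, fun w ↦ ?_⟩
  · have h := hη.1 v 1
    rw [W.conjH1_one_holds p H, AddMonoidHom.id_apply] at h
    exact W.index_nsmul_mem_selmerLocalKerPrimary_of_resSubgroupH1_mem p H hH h
  · have h := hη.2 w 1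
    rw [W.conjH1_one_holds p H, AddMonoidHom.id_apply] at h
    exact W.index_nsmul_mem_selmerLocalKerPrimary_of_resSubgroupH1_mem p H hH h

/-- **Restriction carries `Sel_{p^∞}(E/K)` into `Sel_{p^∞}(E/F)`** (`res_H = res_{H ≤ ⊤} ∘ res_⊤`;
the tree's `resH1Hom_subgroupIncl_mem_selmerGroupOver_top_iff` and `resOfLe_mem_selmerGroupOver`).
Dokchitser–Dokchitser 2010, proof of Lemma 4.14. [cite: DokchitserDokchitserAnnals2010, Lemma 4.14 (proof)] -/
theorem resSubgroupH1_mem_selmerGroupOver {η : W.galH1Primary p} (hη : η ∈ selmerGroupPInfty W p) :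
    resSubgroupH1 H (geomPrimaryTorsion W p) η ∈ W.selmerGroupOver p H := by
  rw [resSubgroupH1_eq_resOfLe_comp, AddMonoidHom.comp_apply]
  exact W.resOfLe_mem_selmerGroupOver p le_top
    ((W.resH1Hom_subgroupIncl_mem_selmerGroupOver_top_iff p η).mpr hη)

/-- **`Sel_{p^∞}(E/F)^G`** in the subgroup model: the classes of `Sel_{p^∞}(E/K̄^H)` fixed by the
conjugation action of every `g ∈ Γ_K` (i.e. of `G = Γ_K / H = Gal(F/K)`).
Dokchitser–Dokchitser 2010, Lemma 4.14 (`X_p(E/F)^G`). [cite: DokchitserDokchitserAnnals2010, Lemma 4.14] -/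
def selmerGroupOverInvariants : AddSubgroup (W.subgroupH1 p H) :=
  W.selmerGroupOver p H ⊓
    ⨅ g : Field.absoluteGaloisGroup K, (W.conjH1 p H g - AddMonoidHom.id _).ker

/-- Membership in `Sel_{p^∞}(E/F)^G`. [cite: DokchitserDokchitserAnnals2010, Lemma 4.14] -/
theorem mem_selmerGroupOverInvariants_iff (y : W.subgroupH1 p H) :
    y ∈ W.selmerGroupOverInvariants p H ↔
      y ∈ W.selmerGroupOver p H ∧ ∀ g : Field.absoluteGaloisGroup K, W.conjH1 p H g y = y := by
  simp only [selmerGroupOverInvariants, AddSubgroup.mem_inf, AddSubgroup.mem_iInf,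
    AddMonoidHom.mem_ker, AddMonoidHom.sub_apply, AddMonoidHom.id_apply, sub_eq_zero]

/-- **The restriction `Sel_{p^∞}(E/K) → Sel_{p^∞}(E/F)^G`.**
[cite: DokchitserDokchitserAnnals2010, Lemma 4.14 (proof)] -/
def selmerRestriction : selmerGroupPInfty W p →+ W.selmerGroupOverInvariants p H :=
  ((resSubgroupH1 H (geomPrimaryTorsion W p)).comp (selmerGroupPInfty W p).subtype).codRestrict
    (W.selmerGroupOverInvariants p H) fun η ↦
      (W.mem_selmerGroupOverInvariants_iff p H _).mpr
        ⟨W.resSubgroupH1_mem_selmerGroupOver p H η.2,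
          fun g ↦ conjH1_resSubgroupH1_eq H g (η : W.galH1Primary p)⟩

/-- Values of `selmerRestriction`. [folklore] -/
@[simp]
theorem coe_selmerRestriction (η : selmerGroupPInfty W p) :
    ((W.selmerRestriction p H η : W.selmerGroupOverInvariants p H) : W.subgroupH1 p H) =
      resSubgroupH1 H (geomPrimaryTorsion W p) η :=
  rfl

variable [Fact p.Prime] [W.IsElliptic] [H.FiniteIndex]

/-- **Dokchitser–Dokchitser 2010, Lemma 4.14** (subgroup model, at the level of `ℤ_p`-coranks):
for an elliptic curve `E = W` over a number field `K`, a prime `p`, and an open normal subgroup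
`H ≤ Γ_K` of finite index (`F = K̄^H`, `G = Γ_K/H = Gal(F/K)`),
`corank_{ℤ_p} Sel_{p^∞}(E/K) = corank_{ℤ_p} Sel_{p^∞}(E/F)^G`: the restriction
`Sel_{p^∞}(E/K) → Sel_{p^∞}(E/F)^G` has kernel killed by `|G|` (`cor ∘ res = |G|`) and cokernel
killed by `|G|²` (`res ∘ cor = ∑_G g_*` and the local half), so the coranks agree
(`zpCorank_eq_of_nsmul_ker_of_nsmul_coker`). Printed: "rk_p(E/K) = dim_{ℚ_p} X_p(E/F)^G … kernel
and cokernel are killed by `|G|²`. The result follows by taking duals and tensoring with `ℚ_p`."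
Hypothesis `hfin`: the `p`-torsion of `Sel_{p^∞}(E/F)^G` is finite (finiteness of the `p`-Selmer
group of `E/F`, Silverman X.4.2(b), in the subgroup model).
[cite: DokchitserDokchitserAnnals2010, Lemma 4.14] -/
theorem selmerCorank_eq_zpCorank_selmerGroupOverInvariants
    (hH : IsOpen (H : Set (Field.absoluteGaloisGroup K)))
    (hfin : Finite (W.selmerGroupOverInvariants p H)[(p : ℤ)]) :
    W.selmerCorank p = zpCorank (W.selmerGroupOverInvariants p H) p := by
  haveI := hfin
  haveI : Finite (selmerGroupPInfty W p)[(p : ℤ)] := finite_torsionBy_selmerGroupPInfty W p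
  haveI : CompactSpace (Field.absoluteGaloisGroup K) := compactSpace_absoluteGaloisGroup K
  -- both groups are `p`-primary
  have hA : ∀ a : selmerGroupPInfty W p, ∃ n : ℕ, p ^ n • a = 0 := fun a ↦ by
    obtain ⟨n, hn⟩ := exists_pow_nsmul_eq_zero_galH1Primary W p (a : W.galH1Primary p)
    exact ⟨n, Subtype.ext (by rw [AddSubmonoidClass.coe_nsmul, hn, ZeroMemClass.coe_zero])⟩
  have hM : ∀ m : geomPrimaryTorsion W p, ∃ k : ℕ, p ^ k • m = 0 := fun m ↦ by
    obtain ⟨k, hk⟩ := AddCommGroup.mem_primaryComponent.mp m.2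
    exact ⟨k, Subtype.ext (by rw [AddSubmonoidClass.coe_nsmul, hk, ZeroMemClass.coe_zero])⟩
  have hB : ∀ b : W.selmerGroupOverInvariants p H, ∃ n : ℕ, p ^ n • b = 0 := fun b ↦ by
    obtain ⟨n, hn⟩ := exists_pow_nsmul_eq_zero_subgroupH1 H (Subgroup.isClosed_of_isOpen H hH)
      hM (b : W.subgroupH1 p H)
    exact ⟨n, Subtype.ext (by rw [AddSubmonoidClass.coe_nsmul, hn, ZeroMemClass.coe_zero])⟩
  have hidx : H.index ≠ 0 := Subgroup.FiniteIndex.index_ne_zero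
  refine zpCorank_eq_of_nsmul_ker_of_nsmul_coker (W.selmerRestriction p H) hA hB
    (N := H.index * H.index) (mul_ne_zero hidx hidx) (fun a ha ↦ ?_) (fun b ↦ ?_)
  · -- kernel: `res a = 0 ⇒ [Γ_K : H] • a = 0`
    haveI : Fintype (Field.absoluteGaloisGroup K ⧸ H) := Fintype.ofFinite _
    have h0 : resSubgroupH1 H (geomPrimaryTorsion W p) (a : W.galH1Primary p) = 0 := by
      rw [← coe_selmerRestriction, ha]; rfl
    have h1 := index_nsmul_eq_zero_of_resSubgroupH1_eq_zero H hH h0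
    apply Subtype.ext
    rw [AddSubmonoidClass.coe_nsmul, mul_nsmul, h1, nsmul_zero, ZeroMemClass.coe_zero]
  · -- cokernel: `[Γ_K : H]² • b = res ([Γ_K : H] • cor b)` with `[Γ_K : H] • cor b ∈ Sel(E/K)`
    obtain ⟨hbT, hbinv⟩ := (W.mem_selmerGroupOverInvariants_iff p H _).mp b.2
    obtain ⟨x, hx⟩ := exists_resSubgroupH1_eq_index_nsmul_of_forall_conjH1_eq H hH hbinv
    have hxT : resSubgroupH1 H (geomPrimaryTorsion W p) x ∈ W.selmerGroupOver p H := by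
      rw [hx]; exact AddSubgroup.nsmul_mem _ hbT _
    have hxS := W.index_nsmul_mem_selmerGroupPInfty_of_resSubgroupH1_mem p H hH hxT
    refine ⟨⟨H.index • x, hxS⟩, Subtype.ext ?_⟩
    rw [coe_selmerRestriction, AddSubmonoidClass.coe_nsmul]
    change resSubgroupH1 H (geomPrimaryTorsion W p) (H.index • x) = _
    rw [map_nsmul, hx, ← mul_nsmul]

end WeierstrassCurve
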